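import Literature.MathematicalPhysics.QuantumFieldTheory.Balaban1983to89.B14Ineq319From190
import Literature.MathematicalPhysics.QuantumFieldTheory.Balaban1983to89.B14Eq119SecondFunction

/-!
# `Balaban1983to89.B14Eq119From190` — T. Bałaban, *Convergent renormalization expansions for lattice gauge theories*,
# Commun. Math. Phys. **119** (1988) 243–285 [Balaban1988Convergent] = [III], p. 250 after (1.19): *"both configurations U₁,
# U_{1,□′} are determined by the same configuration V on □′^{∼3}, hence on □′^{∼2} the difference between these configurations
# is very small. More precisely |U₁U_{1,□′}⁻¹ − 1| < O(1)B₃·exp(−δLM₂R₁)ε₁, and the bound can be made much smaller than δ₀, if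
# M₂R₁ is large enough. Thus the second function in the product (1.19) is equal to 1"* — the BOUND derived on p29's lattice
# model at level `k = 0` from the exponential decay property (190) of [15] = [Balaban1985Variational] (the §3 mechanism
# (3.17)–(3.19) p. 268 at the first step), and gen-3's *"Thus the second function … is equal to 1"*
# (`B14.Eq119SecondFunction.secondFunction_eq_one`) with its hypothesis `‖U₁(b)U_{1,□′}(b)⁻¹ − 1‖ ≤ ε` DISCHARGED

statement-level skeleton of published theorems with citation tags; proofs where landed; nothing here is a claim
about the Yang–Mills mass gap

CITATION HEADER (lean-in-tree rule 2026-08-18).  T. Bałaban, *Convergent renormalization expansions for lattice gauge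
theories*, Commun. Math. Phys. **119**, 243–285 (1988), doi:10.1007/BF01217741, bib `Balaban1988Convergent` (cell paper
B14 = "[III]").  PDF held: `paper:balaban1988-cmp119-convergent-renormalization` (journal page = PDF page + 242), p. 250
[PDF 8] (OCR `p0008.txt`, this seat 2026-08-21; the ROWS-B14 row was verified on the x2 render p008 by r11 gen 3) and p. 268
[PDF 26] ((3.17)–(3.19), x2 render).  "[15]" = [Balaban1985Variational] (190) p. 308 (`B11SectG.Ineq190`); "[12]" =
[Balaban1985Averaging] ((164)/(166) inside p29's `B14Ineq319Proof`, (24) `‖e^{ix} − 1‖ ≤ ‖x‖` inside gen-3's file).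

WHAT IS REPRODUCED.  SKELETON row **B14.Eq1.18–1.19** (member: the p. 250 sentence after (1.19); rows of record
`lit-balaban-r11/ROWS-B14.md`: «(1.19)₂ = 1 mechanism PROVED; the bound on U₁U_{1,□′}⁻¹ itself stays the [B11] (190)
hypothesis»), mega-formalization `lit-balaban`, HOME `run/shared/lean/pub/lit-balaban/`, unit `lit-balaban-r11` gen 7
(reader/typer and fold owner of block B14).  KNITTING — used BY NAME, nothing restated: r11's
`B14Ineq319From190.boundH318_of_ineq190` (the bound on `𝐇_{1,□′}` from (190), one localised piece), p29's
`B14Ineq319Proof.stdRep_dev_le_finer_local` (the [12]-mechanism *"without the factor L"*, here at `k = 0` where `M⁰ = id`,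
`B7Prop2Explicit.avgIter_zero`), gen-3's `B14.Eq119SecondFunction.secondFunction_eq_one` and `small_if_M2R1_large`.

THE PRINTED TEXT (p. 250, verbatim up to OCR): *"Consider a cube □′ ⊂ R₁^c. For this cube we now have the product of the two
characteristic functions, χ({sup_{b∈(□′^{∼2})*} |A(b)| < δ₀}) χ({sup_{b∈(□′^{∼2})*} |exp ig₀A(b) U₁(b)(U_{1,□′})(b)⁻¹ − 1| < 2δ₀}).
(1.19)  The cube □′^{∼4} is contained in Ω₁, and both configurations U₁, U_{1,□′} are determined by the same configuration V on
□′^{∼3}, hence on □′^{∼2} the difference between these configurations is very small. More precisely |U₁U_{1,□′}⁻¹ − 1| <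
O(1)B₃·exp(−δLM₂R₁)ε₁, and the bound can be made much smaller than δ₀, if M₂R₁ is large enough. Thus the second function in
the product (1.19) is equal to 1, and we can omit it."*  The mechanism is the one printed in §3, p. 268: *"This follows from
the identity analogous to (3.6), U_{k+1} = … = (exp iL⁻¹η𝐇_{k+1,□′}(…) U_{k+1,□′})^{u⁻¹_{k+1,□′}} (3.17) … the argument of the
function 𝐇_{k+1,□} is bounded by 44d²B₃ε_{k+1}, and has a support in a boundary layer … Thus, the function 𝐇_{k+1,□′} is
bounded by B₃exp(−δLM₂R_{k+1})44d²B₃ε_{k+1}"* — read at the first step (`k + 1 = 1`, no averaging: `V^{(0)} = U₁`).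

WHAT THIS FILE PROVES (kernel-checked, zero `sorry`; no `def`, no new `Prop`, no new named fact; axioms standard).  In p29's
lattice model at level `k = 0` (`U₁(b) = ((e^{iL⁻¹𝐇}U₀)^{u⁻¹})(b)`, `U₀ = U_{1,□′}`, `𝐇 = 𝐇_{1,□′}`, `u = glev`; the statements
keep p29's literal `avgIter L · 0` = `M⁰`, which is the identity by `B7Prop2Explicit.avgIter_zero` (`rfl`)):
* `dev119_le_lattice_of_ineq190` — **the bound** `‖U₁(b)U_{1,□′}(b)⁻¹ − 1‖ ≤ O(1)·B₃e^{−δLM₂R₁}ε₁` with print's O(1) EXPLICIT,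
  `O(1) = (68(d+1)+160d)·44d²B₃`, from: (190) for the block size `bout` of `𝐇_{1,□′}` at the base point `y` and every `t`,
  (2.61), the argument field of B-size `≤ 44d²B₃ε₁` vanishing on the blocks closer than `D` to `y`, `δLM₂R₁ ≤ τD`, `Cκ_Bc ≤ B₃`,
  mean-value domination, ONE dictionary hypothesis `hdom` (the block size dominates `‖𝐇(y′,μ)‖` at the two sites of the
  bond), and p29's located side conditions at `k = 0` (Prop. 2's regime for `U₀`, the four `s`-conditions on
  `S = B₃e^{−δLM₂R₁}44d²B₃ε₁`).
* `secondFunction119_eq_one_of_ineq190` — **"Thus the second function in the product (1.19) is equal to 1"** for a finite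
  bond set `(□′^{∼2})*` (an index type `β` with bond map `b ↦ (q_b, κ_b)`): gen-3's indicator `secondFunction bonds
  (b ↦ e^{ix_b}·U₁(b)U_{1,□′}(b)⁻¹) δ₀ = 1` on the support of the first function (`‖x_b‖ < δ₀`, `x_b = g₀A(b)` self-adjoint),
  with `‖U₁(b)U_{1,□′}(b)⁻¹ − 1‖ ≤ ε` DISCHARGED bondwise by the first theorem (`ε = O(1)B₃e^{−δLM₂R₁}ε₁`) and the smallness
  `ε ≤ δ₀/2`, `δ₀ ≤ 1`; `secondFunction119_eq_one_of_ineq190_M2R1` — the same with `ε ≤ δ₀/2` from gen-3's threshold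
  *"if M₂R₁ is large enough"*: `M₂R₁ ≥ log(2·O(1)·B₃ε₁/δ₀)/(δL)`.
HONEST SCOPE.  (190) itself, (2.61), the B-size bound `44d²B₃ε₁` and the localisation distance of the argument field of
`𝐇_{1,□′}` (the p. 268 sentences read at the first step — p. 250 itself only says *"determined by the same configuration V on
□′^{∼3}"*), the mean-value reading `hmv` and the dictionary `hdom` are HYPOTHESES in the printed shapes; the identification
`U₁(b)U_{1,□′}(b)⁻¹ = ((e^{iL⁻¹𝐇}U₀)^{u⁻¹})(b)·U₀(b)⁻¹` is the (3.17)-representation taken as the MODEL (as in p29's (3.19));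
the lattice model is p29's ((M1)–(M4) of `B14Ineq319Proof`: `ℤ^d` carriers of [12]/[14], values in a C⋆-algebra for §2 (gen-3's
`expUnitary`), resp. a complete normed `ℂ`-algebra with `‖1‖ = 1` for §1, `G ⊂ U1` averaging-closed, gauge fixing `glev`,
(52)-type input).  Value = the p. 250 bound of row B14.Eq1.18–1.19 reduced to (190) plus located data and the «second function
= 1» claim with no `U₁U_{1,□′}⁻¹`-hypothesis left, kernel-checked; NOT summit progress.
-/

open NormedSpace Finset

namespace Literature.MathematicalPhysics.QuantumFieldTheory.Balaban1983to89.B14Eq119From190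

open Literature.MathematicalPhysics.QuantumFieldTheory.Balaban1983to89
open B7Prop1Explicit B7Prop2Explicit B7Prop3Flat B7Eq92Concrete B7Eq162General
open B11SectG B14Ineq319Proof B14Ineq319From190
open selfAdjoint

variable {g : B6.Geometry} {FB : Type} [AddCommGroup FB] [Module ℝ FB]
variable {d : ℕ}

/-! ## §1 The p. 250 bound `|U₁U_{1,□′}⁻¹ − 1| < O(1)B₃exp(−δLM₂R₁)ε₁` from (190), level `k = 0` -/

section Bound

-- `𝔸` in `Type` (not `Type*`): `B11SectG.BlockNorm` takes its field space in `Type`.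
variable {𝔸 : Type} [NormedRing 𝔸] [NormedAlgebra ℂ 𝔸] [CompleteSpace 𝔸] [NormOneClass 𝔸]

/-- **p. 250, THE BOUND, ON THE LATTICE MODEL, FROM [15] (190)**: *"|U₁U_{1,□′}⁻¹ − 1| < O(1)B₃·exp(−δLM₂R₁)ε₁"* with
`O(1) = (68(d+1)+160d)·44d²B₃` — for `U₁(b) = M⁰((e^{iL⁻¹𝐇}U₀)^{u⁻¹})(b)`, `U_{1,□′}(b) = M⁰(U₀)(b)` (`M⁰ = id`, `avgIter_zero`):
the bound on `𝐇 = 𝐇_{1,□′}` DERIVED from (190) (`boundH318_of_ineq190` with `R1 = R₁`, `εk1 = ε₁`) through the dictionary `hdom`,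
then p29's `stdRep_dev_le_finer_local` at `k = 0` with `S = B₃e^{−δLM₂R₁}44d²B₃ε₁`.
[cite: Balaban1988Convergent, (1.19) p.250; Balaban1985Variational, (190) p.308] -/
theorem dev119_le_lattice_of_ineq190
    -- [15]'s block-majorant data
    {T : Type*} {bB : BlockNorm g FB} {bout : BlockNorm g (B7Prop1Explicit.Site d → Fin d → 𝔸)}
    {dH : T → FB →ₗ[ℝ] (B7Prop1Explicit.Site d → Fin d → 𝔸)} {C δ₀ σ τ c D : ℝ}
    (h190 : ∀ t, Ineq190 bB bout (dH t) C δ₀) (hC : 0 ≤ C) (hd : ∀ a b : g.Site, 0 ≤ g.dist a b)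
    (hrow : RowSum g σ c) (hτ : 0 ≤ τ) (hστ : σ + τ ≤ δ₀ / 8) (B : FB) (y : g.Site)
    {B₃ δ M₂ R₁ ε₁ : ℝ}
    (hm : ∀ y', bB.loc y' B ≤ 44 * (d : ℝ) ^ 2 * B₃ * ε₁) (hD : ∀ y', bB.loc y' B ≠ 0 → D ≤ g.dist y y')
    {Hf : B7Prop1Explicit.Site d → Fin d → 𝔸}
    (hmv : ∀ s : ℝ, (∀ t, bout.loc y (dH t B) ≤ s) → bout.loc y Hf ≤ s)
    -- the lattice data (p29) at level 0
    {L : ℕ} (hL : 2 ≤ L) {G : Subgroup 𝔸ˣ} (hG : AvgClosed d L G)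
    {U₀ : B7Prop1Explicit.Site d → Fin d → 𝔸ˣ} (hU₀ : ∀ x κ, U₀ x κ ∈ G) {α₀ : ℝ} (hα : 0 < α₀)
    (hα3 : C0 d * α₀ ≤ 1 / 3) (hα4 : 4 * α₀ ≤ c2' d L) (h52 : pdev U₀ < α₀ * (((L : ℝ) ^ 0)⁻¹) ^ 2)
    (q : B7Prop1Explicit.Site d) (κ : Fin d)
    (hgeom : δ * L * M₂ * R₁ ≤ τ * D) (hCB : C * bB.κ * c ≤ B₃) (hB₃ : 0 ≤ B₃)
    -- the dictionary
    (hdom : ∀ y' μ, B7Prop1Local.InBox (B7Prop1Local.loK L 0 q) (B7Prop1Local.bondHiK L 0 q κ) y' →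
      ‖Hf y' μ‖ ≤ bout.loc y Hf)
    -- p29's located inputs on `S = B₃e^{−δLM₂R₁}44d²B₃ε₁`
    (hsmall : Real.exp (4 * (800 * ((d : ℝ) + 1) ^ 2 * ((d : ℝ) + 4)) * α₀)
      * (1 + 8 * (131072 * ((d : ℝ) + 1) ^ 2) * (B₃ * Real.exp (-(δ * L * M₂ * R₁)) * (44 * (d : ℝ) ^ 2 * B₃) * ε₁)) ≤ 2)
    (hc₃ : 2 * (B₃ * Real.exp (-(δ * L * M₂ * R₁)) * (44 * (d : ℝ) ^ 2 * B₃) * ε₁) ≤ c3 d L)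
    (hsm : 2048 * (d : ℝ) * (B₃ * Real.exp (-(δ * L * M₂ * R₁)) * (44 * (d : ℝ) ^ 2 * B₃) * ε₁) ≤ 1)
    (h1 : 128 * (B₃ * Real.exp (-(δ * L * M₂ * R₁)) * (44 * (d : ℝ) ^ 2 * B₃) * ε₁) ≤ 1) (hL1 : 1 ≤ L) :
    ‖((avgIter L
          (gaugeAct (B7Eq84Concrete.glev L hL1 U₀
              (expCfg (fun z μ => ((Complex.I : ℂ) * ((((L : ℝ) ^ (0 + 1))⁻¹ : ℝ) : ℂ)) • Hf z μ)) 0 0)⁻¹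
            (expCfg (fun z μ => ((Complex.I : ℂ) * ((((L : ℝ) ^ (0 + 1))⁻¹ : ℝ) : ℂ)) • Hf z μ) * U₀)) 0 q κ : 𝔸ˣ) : 𝔸)
        * (((avgIter L U₀ 0 q κ)⁻¹ : 𝔸ˣ) : 𝔸) - 1‖
      ≤ (68 * ((d : ℝ) + 1) + 160 * d) * (B₃ * Real.exp (-(δ * L * M₂ * R₁)) * (44 * (d : ℝ) ^ 2 * B₃) * ε₁) := by
  have hloc := boundH318_of_ineq190 h190 hC hd hrow hτ hστ B y hm hD hmv hgeom hCB hB₃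
  have hS : 0 ≤ B₃ * Real.exp (-(δ * L * M₂ * R₁)) * (44 * (d : ℝ) ^ 2 * B₃) * ε₁ :=
    (bout.loc_nonneg y Hf).trans hloc
  have hH : ∀ y' μ, B7Prop1Local.InBox (B7Prop1Local.loK L 0 q) (B7Prop1Local.bondHiK L 0 q κ) y' →
      ‖Hf y' μ‖ ≤ B₃ * Real.exp (-(δ * L * M₂ * R₁)) * (44 * (d : ℝ) ^ 2 * B₃) * ε₁ :=
    fun y' μ hy => (hdom y' μ hy).trans hloc
  exact (stdRep_dev_le_finer_local hL hG hU₀ hα hα3 hα4 h52 Hf q κ hS hH hsmall hc₃ hsm h1 hL1).2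

end Bound

/-! ## §2 "Thus the second function in the product (1.19) is equal to 1" -/

section SecondFunction

variable {𝔸 : Type} [CStarAlgebra 𝔸] [Nontrivial 𝔸]

/-- **p. 250, «Thus the second function in the product (1.19) is equal to 1», FROM [15] (190)**: for a finite bond set
`(□′^{∼2})*` (index type `β`, bond `b ↦ ⟨q_b, q_b + e_{κ_b}⟩` of the unit lattice), gen-3's indicator
`χ({sup_b ‖e^{ix_b}U₁(b)U_{1,□′}(b)⁻¹ − 1‖ < 2δ₀}) = 1` on the support of the first function (`‖x_b‖ < δ₀`, `x_b = g₀A(b)`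
self-adjoint), with gen-3's hypothesis `‖U₁(b)U_{1,□′}(b)⁻¹ − 1‖ ≤ ε` DISCHARGED bondwise by `dev119_le_lattice_of_ineq190`
(`ε = (68(d+1)+160d)·B₃e^{−δLM₂R₁}44d²B₃ε₁`, one base block `y` whose size dominates `𝐇_{1,□′}` at the sites of every bond) and
the printed smallness *"much smaller than δ₀"* as `ε ≤ δ₀/2`, `δ₀ ≤ 1`.
[cite: Balaban1988Convergent, (1.19) p.250; Balaban1985Variational, (190) p.308] -/
theorem secondFunction119_eq_one_of_ineq190
    {T : Type*} {bB : BlockNorm g FB} {bout : BlockNorm g (B7Prop1Explicit.Site d → Fin d → 𝔸)}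
    {dH : T → FB →ₗ[ℝ] (B7Prop1Explicit.Site d → Fin d → 𝔸)} {C δ₀' σ τ c D : ℝ}
    (h190 : ∀ t, Ineq190 bB bout (dH t) C δ₀') (hC : 0 ≤ C) (hd : ∀ a b : g.Site, 0 ≤ g.dist a b)
    (hrow : RowSum g σ c) (hτ : 0 ≤ τ) (hστ : σ + τ ≤ δ₀' / 8) (B : FB) (y : g.Site)
    {B₃ δ M₂ R₁ ε₁ δ₀ : ℝ}
    (hm : ∀ y', bB.loc y' B ≤ 44 * (d : ℝ) ^ 2 * B₃ * ε₁) (hD : ∀ y', bB.loc y' B ≠ 0 → D ≤ g.dist y y')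
    {Hf : B7Prop1Explicit.Site d → Fin d → 𝔸}
    (hmv : ∀ s : ℝ, (∀ t, bout.loc y (dH t B) ≤ s) → bout.loc y Hf ≤ s)
    {L : ℕ} (hL : 2 ≤ L) {G : Subgroup 𝔸ˣ} (hG : AvgClosed d L G)
    {U₀ : B7Prop1Explicit.Site d → Fin d → 𝔸ˣ} (hU₀ : ∀ x κ, U₀ x κ ∈ G) {α₀ : ℝ} (hα : 0 < α₀)
    (hα3 : C0 d * α₀ ≤ 1 / 3) (hα4 : 4 * α₀ ≤ c2' d L) (h52 : pdev U₀ < α₀ * (((L : ℝ) ^ 0)⁻¹) ^ 2)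
    (hgeom : δ * L * M₂ * R₁ ≤ τ * D) (hCB : C * bB.κ * c ≤ B₃) (hB₃ : 0 ≤ B₃)
    (hsmall : Real.exp (4 * (800 * ((d : ℝ) + 1) ^ 2 * ((d : ℝ) + 4)) * α₀)
      * (1 + 8 * (131072 * ((d : ℝ) + 1) ^ 2) * (B₃ * Real.exp (-(δ * L * M₂ * R₁)) * (44 * (d : ℝ) ^ 2 * B₃) * ε₁)) ≤ 2)
    (hc₃ : 2 * (B₃ * Real.exp (-(δ * L * M₂ * R₁)) * (44 * (d : ℝ) ^ 2 * B₃) * ε₁) ≤ c3 d L)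
    (hsm : 2048 * (d : ℝ) * (B₃ * Real.exp (-(δ * L * M₂ * R₁)) * (44 * (d : ℝ) ^ 2 * B₃) * ε₁) ≤ 1)
    (h1 : 128 * (B₃ * Real.exp (-(δ * L * M₂ * R₁)) * (44 * (d : ℝ) ^ 2 * B₃) * ε₁) ≤ 1) (hL1 : 1 ≤ L)
    -- the bond set `(□′^{∼2})*` and the first function of (1.19)
    {β : Type*} (bonds : Finset β) (bq : β → B7Prop1Explicit.Site d) (bκ : β → Fin d) (x : β → selfAdjoint 𝔸)
    (hx : ∀ b ∈ bonds, ‖x b‖ < δ₀)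
    (hdom : ∀ b ∈ bonds, ∀ y' μ,
      B7Prop1Local.InBox (B7Prop1Local.loK L 0 (bq b)) (B7Prop1Local.bondHiK L 0 (bq b) (bκ b)) y' →
        ‖Hf y' μ‖ ≤ bout.loc y Hf)
    -- «much smaller than δ₀»
    (hε : (68 * ((d : ℝ) + 1) + 160 * d) * (B₃ * Real.exp (-(δ * L * M₂ * R₁)) * (44 * (d : ℝ) ^ 2 * B₃) * ε₁) ≤ δ₀ / 2)
    (hδ₀ : δ₀ ≤ 1) :
    B14.Eq119SecondFunction.secondFunction bonds (fun b => (expUnitary (x b) : 𝔸) *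
        (((avgIter L
            (gaugeAct (B7Eq84Concrete.glev L hL1 U₀
                (expCfg (fun z μ => ((Complex.I : ℂ) * ((((L : ℝ) ^ (0 + 1))⁻¹ : ℝ) : ℂ)) • Hf z μ)) 0 0)⁻¹
              (expCfg (fun z μ => ((Complex.I : ℂ) * ((((L : ℝ) ^ (0 + 1))⁻¹ : ℝ) : ℂ)) • Hf z μ) * U₀)) 0 (bq b) (bκ b)
              : 𝔸ˣ) : 𝔸)
          * (((avgIter L U₀ 0 (bq b) (bκ b))⁻¹ : 𝔸ˣ) : 𝔸))) δ₀ = 1 := by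
  refine B14.Eq119SecondFunction.secondFunction_eq_one bonds x _ hx (fun b hb => ?_) hε hδ₀
  exact dev119_le_lattice_of_ineq190 h190 hC hd hrow hτ hστ B y hm hD hmv hL hG hU₀ hα hα3 hα4 h52 (bq b) (bκ b) hgeom hCB
    hB₃ (hdom b hb) hsmall hc₃ hsm h1 hL1

/-- **«and the bound can be made much smaller than δ₀, if M₂R₁ is large enough»** — the same with `ε ≤ δ₀/2` from gen-3's
explicit threshold `B14.Eq119SecondFunction.small_if_M2R1_large`: `M₂R₁ ≥ log(2·O(1)·B₃ε₁/δ₀)/(δL)` with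
`O(1) = (68(d+1)+160d)·44d²B₃` (`B₃, ε₁, δ₀, δ > 0`, `d ≥ 1` for `O(1) > 0`).
[cite: Balaban1988Convergent, (1.19) p.250] -/
theorem secondFunction119_eq_one_of_ineq190_M2R1
    {T : Type*} {bB : BlockNorm g FB} {bout : BlockNorm g (B7Prop1Explicit.Site d → Fin d → 𝔸)}
    {dH : T → FB →ₗ[ℝ] (B7Prop1Explicit.Site d → Fin d → 𝔸)} {C δ₀' σ τ c D : ℝ}
    (h190 : ∀ t, Ineq190 bB bout (dH t) C δ₀') (hC : 0 ≤ C) (hd : ∀ a b : g.Site, 0 ≤ g.dist a b)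
    (hrow : RowSum g σ c) (hτ : 0 ≤ τ) (hστ : σ + τ ≤ δ₀' / 8) (B : FB) (y : g.Site)
    {B₃ δ M₂ R₁ ε₁ δ₀ : ℝ}
    (hm : ∀ y', bB.loc y' B ≤ 44 * (d : ℝ) ^ 2 * B₃ * ε₁) (hD : ∀ y', bB.loc y' B ≠ 0 → D ≤ g.dist y y')
    {Hf : B7Prop1Explicit.Site d → Fin d → 𝔸}
    (hmv : ∀ s : ℝ, (∀ t, bout.loc y (dH t B) ≤ s) → bout.loc y Hf ≤ s)
    {L : ℕ} (hL : 2 ≤ L) {G : Subgroup 𝔸ˣ} (hG : AvgClosed d L G)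
    {U₀ : B7Prop1Explicit.Site d → Fin d → 𝔸ˣ} (hU₀ : ∀ x κ, U₀ x κ ∈ G) {α₀ : ℝ} (hα : 0 < α₀)
    (hα3 : C0 d * α₀ ≤ 1 / 3) (hα4 : 4 * α₀ ≤ c2' d L) (h52 : pdev U₀ < α₀ * (((L : ℝ) ^ 0)⁻¹) ^ 2)
    (hgeom : δ * L * M₂ * R₁ ≤ τ * D) (hCB : C * bB.κ * c ≤ B₃)
    (hsmall : Real.exp (4 * (800 * ((d : ℝ) + 1) ^ 2 * ((d : ℝ) + 4)) * α₀)
      * (1 + 8 * (131072 * ((d : ℝ) + 1) ^ 2) * (B₃ * Real.exp (-(δ * L * M₂ * R₁)) * (44 * (d : ℝ) ^ 2 * B₃) * ε₁)) ≤ 2)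
    (hc₃ : 2 * (B₃ * Real.exp (-(δ * L * M₂ * R₁)) * (44 * (d : ℝ) ^ 2 * B₃) * ε₁) ≤ c3 d L)
    (hsm : 2048 * (d : ℝ) * (B₃ * Real.exp (-(δ * L * M₂ * R₁)) * (44 * (d : ℝ) ^ 2 * B₃) * ε₁) ≤ 1)
    (h1 : 128 * (B₃ * Real.exp (-(δ * L * M₂ * R₁)) * (44 * (d : ℝ) ^ 2 * B₃) * ε₁) ≤ 1) (hL1 : 1 ≤ L)
    {β : Type*} (bonds : Finset β) (bq : β → B7Prop1Explicit.Site d) (bκ : β → Fin d) (x : β → selfAdjoint 𝔸)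
    (hx : ∀ b ∈ bonds, ‖x b‖ < δ₀)
    (hdom : ∀ b ∈ bonds, ∀ y' μ,
      B7Prop1Local.InBox (B7Prop1Local.loK L 0 (bq b)) (B7Prop1Local.bondHiK L 0 (bq b) (bκ b)) y' →
        ‖Hf y' μ‖ ≤ bout.loc y Hf)
    -- «if M₂R₁ is large enough»
    (hd1 : 1 ≤ d) (hB₃ : 0 < B₃) (hε₁ : 0 < ε₁) (hδ₀ : 0 < δ₀) (hδ₀1 : δ₀ ≤ 1) (hδ : 0 < δ)
    (hM₂R₁ : Real.log (2 * ((68 * ((d : ℝ) + 1) + 160 * d) * (44 * (d : ℝ) ^ 2 * B₃)) * B₃ * ε₁ / δ₀) / (δ * L)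
      ≤ M₂ * R₁) :
    B14.Eq119SecondFunction.secondFunction bonds (fun b => (expUnitary (x b) : 𝔸) *
        (((avgIter L
            (gaugeAct (B7Eq84Concrete.glev L hL1 U₀
                (expCfg (fun z μ => ((Complex.I : ℂ) * ((((L : ℝ) ^ (0 + 1))⁻¹ : ℝ) : ℂ)) • Hf z μ)) 0 0)⁻¹
              (expCfg (fun z μ => ((Complex.I : ℂ) * ((((L : ℝ) ^ (0 + 1))⁻¹ : ℝ) : ℂ)) • Hf z μ) * U₀)) 0 (bq b) (bκ b)
              : 𝔸ˣ) : 𝔸)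
          * (((avgIter L U₀ 0 (bq b) (bκ b))⁻¹ : 𝔸ˣ) : 𝔸))) δ₀ = 1 := by
  have hd' : (1 : ℝ) ≤ d := by exact_mod_cast hd1
  have hO1 : 0 < (68 * ((d : ℝ) + 1) + 160 * d) * (44 * (d : ℝ) ^ 2 * B₃) := by positivity
  have hLr : (0 : ℝ) < L := by exact_mod_cast (lt_of_lt_of_le zero_lt_two hL)
  have hthr := B14.Eq119SecondFunction.small_if_M2R1_large (m := M₂ * R₁) hO1 hB₃ hε₁ hδ₀ hδ hLr hM₂R₁
  have hε : (68 * ((d : ℝ) + 1) + 160 * d) * (B₃ * Real.exp (-(δ * L * M₂ * R₁)) * (44 * (d : ℝ) ^ 2 * B₃) * ε₁)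
      ≤ δ₀ / 2 := by
    have e1 : (68 * ((d : ℝ) + 1) + 160 * d) * (B₃ * Real.exp (-(δ * L * M₂ * R₁)) * (44 * (d : ℝ) ^ 2 * B₃) * ε₁)
        = (68 * ((d : ℝ) + 1) + 160 * d) * (44 * (d : ℝ) ^ 2 * B₃) * B₃ * Real.exp (-(δ * L * (M₂ * R₁))) * ε₁ := by
      rw [show δ * L * (M₂ * R₁) = δ * L * M₂ * R₁ by ring]
      ring
    rw [e1]
    exact hthr
  exact secondFunction119_eq_one_of_ineq190 h190 hC hd hrow hτ hστ B y hm hD hmv hL hG hU₀ hα hα3 hα4 h52 hgeom hCB hB₃.le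
    hsmall hc₃ hsm h1 hL1 bonds bq bκ x hx hdom hε hδ₀1

end SecondFunction

end Literature.MathematicalPhysics.QuantumFieldTheory.Balaban1983to89.B14Eq119From190
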